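import Literature.MathematicalPhysics.QuantumFieldTheory.Balaban1983to89.B9B8KnitVsTaxicab
import Literature.MathematicalPhysics.QuantumFieldTheory.Balaban1983to89.B9Eq3124HZKnitPairReg335Y

/-!
# `Balaban1983to89.B9B8KnitVsTaxicabReg335` — T. Bałaban, *Propagators for lattice gauge theories in a background field*, Commun. Math. Phys. **99** (1985)
# 389–434 [Balaban1985BackgroundPropagators], (3.19) p. 393 and (3.35) p. 396 with [5] = *Averaging operations for lattice gauge theories*, CMP **98** (1985),
# (52)–(53) pp. 26–27: THE KNIT SITE TRANSPORTER `parKnitY` AND def-Y's TAXICAB TRANSPORTER `parSymY` DIFFER BY `8(d+1)²α₀′` AT EVERY CORNER PAIR, FOR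
# EVERY MEMBER OF THE CLASS (3.35) — cell `lit-balaban` J-B's `B9B8KnitVsTaxicab.norm_parKnitY_sub_parSymY_le` WITHOUT the global [5] (52) binder

statement-level skeleton of published theorems with citation tags; proofs where landed; nothing here is a claim about the Yang–Mills mass gap

THE PRINT.  (3.19) p. 393: the site averaging `Q′(U)` and the transporters of §3 are built from the composite contours «defined by (52), (53) in [5]» (the knit
transporter `U(Γ^{(j)}_{y,x})`); def-Y's letters of record use the taxicab contour from the block corner (`parSymY`); [5] (44) p. 24: in the regime (52) the two
differ by the holonomy of a loop of length `≤ 2(d+1)Lʲ` inside the block, `O(α₀)`; (3.35) p. 396: the member's class, where the plaquette bound is LOCAL —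
`α₀L^{−2j}` on the regions of level `j` — so [5]'s GLOBAL (52) at the top scale `k` is not available for a multi-level member.

WHY THIS FILE (cell `pub-ymgap`, node N06, seat `dag-n06-l` = bundle F7 rows 20–21, gen 36; dag-n06-d's ⚑ LOCATED-K ∕ CASCADE-K I.18933, Q-K3).  J-B's
★★★ `norm_parKnitY_sub_parSymY_le` (`‖parKnitY U c_s z − parSymY U c_s z‖ ≤ 8(d+1)²α₀(L^{j(s)}∕Lᵏ)²`) carries `h52 : pdev (liftCfg U) < α₀(Lᵏ)⁻²` and `AvgClosed G`;
its consumers (J-B files 6–7: the coercivity transfer and Thm 3.1's `L²` half at the knit letter) inherit them.  On the certificate's class (3.35) the same bound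
holds member by member WITHOUT (52): both transporters at the corner pair `(c_s, z)` read `U♯` on the block box of `s` only (`compT_bgT_congr`, the taxicab word
stays in the box), where `U♯` may be replaced by its RETRACTION `Û_s` (`B7Eq52RetractionExtension.retrCfg`), which IS `α₀′(L^{j(s)})⁻²`-regular everywhere by
[5] Prop. 2 (`B9Eq3124HZKnitPairReg335Y.pdev_retract_block_lt`, from (3.35) and `K_pl(Mα₀)·L⁴ < α₀′`); J-B's `compT_vs_fw` at `Û_s`, level `k := j(s)`.

WHAT IS PROVED (sorry-free; 0 `def`).  `fw_taxiDirs_eq_flatMap_seg` (the corner taxicab word as signed segments), `hol_fw_taxiDirs_congr` (its holonomy reads the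
block box only), ★★★ `norm_parKnitY_sub_parSymY_le_of_reg335P`: for `G ≤ U(N)` unit-bounded, `c₀ ≤ 10`, `0 ≤ Mα₀`, every `U ∈ (bg9KP … G i).Reg335 c₀ α₀`, x-free
numerics `0 < α₀′`, `C₀α₀′ ≤ ⅓`, `2α₀′ ≤ c₂′`, `K_pl(Mα₀)·L⁴ < α₀′`, and every `z ∈ s ∈ 𝔅`: `‖parKnitY U c_s z − parSymY U c_s z‖ ≤ 8(d+1)²α₀′`;
`norm_parSymY_sub_parKnitY_le_of_reg335P` (the `hδ` shape of J-B file 6's `hs_blkSumY_parSymY_le_knit`).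
HONEST SCOPE.  A per-member re-reading of a landed estimate through the retraction; helper, count-neutral; N06 NOT discharged; nothing continuum ∕ OS ∕ mass
gap ∕ Clay — the Yang–Mills mass gap is NOT proved here.  No `sorry`, no `axiom`, no `instance`, no `notation`, no `def`.
-/

noncomputable section

namespace Literature.MathematicalPhysics.QuantumFieldTheory.Balaban1983to89.B9B8KnitVsTaxicabReg335

open scoped BigOperators Matrix Matrix.Norms.L2Operator
open B7Prop1Explicit renaming Site → LSite
open B7Prop1Explicit (hol disp seg seg_natCast)
open B7Prop1Local (InBox AgreeOn hol_flatMap_seg_congr)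
open B7Prop2Explicit (pdev C0 c2' unitaryUnits avgClosed_unitaryUnits)
open B7Eq52RetractionExtension (retrCfg retrCfg_eq_of_bondIn retrCfg_mem)
open Literature.MathematicalPhysics.QuantumLattice (blockMap blockBase)
open B8Eq119TwistedAxial (bgT)
open B6GlobalChartV1 (PV)
open B6KLevelCensusIndexV1 (KIdx kGeo)
open B6Geom246MultiLevelBox (blkOf blkOf_eq_iff_blk)
open B4Reflection242 (blk)
open B9B8CarrierDictionary (liftCfg liftCfg_mem)
open B9B8AveragingKernelZd (compT)
open B9B8AveragingJunction (parKnitY blk_eq_blockMap blockMap_iterate)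
open B9B8KnitLegsStraight (fw fw_flatMap fw_replicate compT_vs_fw)
open B9B8KnitVsTaxicab (taxiDirs disp_fw_taxiDirs parKnitY_blkCornerY_eq parSymY_blkCornerY_eq_hol)
open B9Thm31SiteCoerciveReg335CubeY (coord_bounds_of_blkOf)
open B9Thm311PositivityKnitLetter (blockBase_eq_smul)
open B9Eq3124HZKnitPairReg335Y (pdev_retract_block_lt compT_bgT_congr inBox_block_of_blk_eq blockBox_lo_le_hi)
open B9C2FormBoxRegimeY (Kpl)
open B9BackgroundsKLevelV1P (bg9KP mem_of_reg335P)
open Node00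

variable {d ℓ : ℕ} {hd : 1 ≤ d + 1} {hL : Odd (ℓ + 1) ∧ 1 < ℓ + 1} {b₀ b₁ : ℝ}

/-- the corner taxicab word `fw (taxiDirs v)`, `v ≥ 0`, IS the signed-segment word `seg_0(v_0) ⋯ seg_d(v_d)`. [cite: Balaban1985BackgroundPropagators, (3.40) p.397; Balaban1985Averaging, (9) p.18, bookkeeping] -/
theorem fw_taxiDirs_eq_flatMap_seg {D : ℕ} {v : LSite D} (hv : 0 ≤ v) :
    fw (taxiDirs v) = (List.finRange D).flatMap fun μ => seg μ (v μ) := by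
  rw [taxiDirs, fw_flatMap]
  refine List.flatMap_congr fun μ _ => ?_
  rw [fw_replicate, Int.toNat_of_nonneg (hv μ)]

/-- ★ the holonomy of the corner taxicab word to a point of the block box READS THE BLOCK BOX ONLY: two configurations agreeing on the box `[Lʲy, Lʲy + (Lʲ−1)𝟙]` give
the same `U(Γ^{taxi}_{Lʲy → x})` for `⌊x∕Lʲ⌋ = y`. [cite: Balaban1985BackgroundPropagators, (3.40) p.397; Balaban1985Averaging, p.24 (locality)] -/
theorem hol_fw_taxiDirs_congr {𝔸 : Type} [NormedRing 𝔸] [NormedAlgebra ℂ 𝔸] [CompleteSpace 𝔸] {V V' : LSite (d + 1) → Fin (d + 1) → 𝔸ˣ} {j : ℕ}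
    {y x : LSite (d + 1)} (hx : blk ((ℓ + 1) ^ j) x = y)
    (hag : AgreeOn (blockBase ((ℓ + 1) ^ j) y) (blockBase ((ℓ + 1) ^ j) y + ((((ℓ + 1 : ℕ) : ℤ) ^ j) - 1) • (1 : LSite (d + 1))) V V') :
    hol V (blockBase ((ℓ + 1) ^ j) y) (fw (taxiDirs (x - blockBase ((ℓ + 1) ^ j) y))) =
      hol V' (blockBase ((ℓ + 1) ^ j) y) (fw (taxiDirs (x - blockBase ((ℓ + 1) ^ j) y))) := by
  have hxin := inBox_block_of_blk_eq (d := d) (ℓ := ℓ) hx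
  have hlo : InBox (blockBase ((ℓ + 1) ^ j) y) (blockBase ((ℓ + 1) ^ j) y + ((((ℓ + 1 : ℕ) : ℤ) ^ j) - 1) • (1 : LSite (d + 1)))
      (blockBase ((ℓ + 1) ^ j) y) := fun μ => ⟨le_rfl, blockBox_lo_le_hi (d := d) (ℓ := ℓ) j y μ⟩
  have hv : 0 ≤ x - blockBase ((ℓ + 1) ^ j) y := fun μ => by
    have := (hxin μ).1; simp only [Pi.sub_apply, Pi.zero_apply]; linarith
  rw [fw_taxiDirs_eq_flatMap_seg hv]
  exact hol_flatMap_seg_congr hag (x - blockBase ((ℓ + 1) ^ j) y) _ (List.nodup_finRange _) _ hlo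
    fun κ _ => by rw [Pi.sub_apply, add_sub_cancel]; exact hxin κ

section Members

variable {N : ℕ} [Nonempty (Fin N)] (i : KIdx d ℓ hd hL b₀ b₁) {G : Subgroup (Matrix (Fin N) (Fin N) ℂ)ˣ}

/-- ★★★ **THE KNIT AND THE TAXICAB SITE TRANSPORTERS DIFFER BY `8(d+1)²α₀′` AT EVERY CORNER PAIR, FOR EVERY MEMBER OF THE CLASS (3.35)**: for `G ≤ U(N)`
unit-bounded, `c₀ ≤ 10`, `0 ≤ Mα₀`, `U ∈ (bg9KP …).Reg335 c₀ α₀`, x-free numerics `0 < α₀′`, `C₀α₀′ ≤ ⅓`, `2α₀′ ≤ c₂′`, `K_pl(Mα₀)·L⁴ < α₀′`, and `z ∈ s ∈ 𝔅`: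
`‖parKnitY U c_s z − parSymY U c_s z‖ ≤ 8(d+1)²α₀′` — J-B's `compT_vs_fw` at the RETRACTION `Û_s` (`α₀′(L^{j(s)})⁻²`-regular everywhere, [5] Prop. 2) and the
scale `k := j(s)`, after both transporters are moved from `U♯` to `Û_s` (they read the block box only).
[cite: Balaban1985BackgroundPropagators, (3.19) p.393, (3.35) p.396, (3.40) p.397; Balaban1985Averaging, (52)–(53) pp.26–27, (44) p.24, Prop. 2 p.26] -/
theorem norm_parKnitY_sub_parSymY_le_of_reg335P (hG1 : ∀ u : (Matrix (Fin N) (Fin N) ℂ)ˣ, u ∈ G → ‖(u : Matrix (Fin N) (Fin N) ℂ)‖ ≤ 1)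
    (hGU : G ≤ unitaryUnits (Matrix (Fin N) (Fin N) ℂ))
    {U : CfgY (Matrix (Fin N) (Fin N) ℂ) i} {c₀ α₀ : ℝ} (hc : c₀ ≤ 10) (hMα : 0 ≤ (kGeo i).M * α₀)
    (hreg : (bg9KP (Matrix (Fin N) (Fin N) ℂ) G i).Reg335 c₀ α₀ U) {α₀' : ℝ} (hα' : 0 < α₀') (hα3 : C0 (d + 1) * α₀' ≤ 1 / 3)
    (hα2 : 2 * α₀' ≤ c2' (d + 1) (ℓ + 1)) (hK : Kpl i ((kGeo i).M * α₀) * (kGeo i).L ^ 4 < α₀') {z : SiteY i} {s : BlkY i} (h : blkOf i.D.toDomains z = s) :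
    ‖(parKnitY i U (blkCornerY i s) z : Matrix (Fin N) (Fin N) ℂ) - parSymY i U (blkCornerY i s) z‖ ≤ 8 * ((d : ℝ) + 1) ^ 2 * α₀' := by
  letI : CStarAlgebra (Matrix (Fin N) (Fin N) ℂ) := {}
  have hL1 : 1 ≤ ℓ + 1 := Nat.succ_pos ℓ
  have hL2 : 2 ≤ ℓ + 1 := hL.2
  have hd1 : 1 ≤ d + 1 := Nat.succ_pos d
  obtain ⟨hKeq, hc'⟩ := parKnitY_blkCornerY_eq i U h
  have hSeq := parSymY_blkCornerY_eq_hol i U h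
  set j : ℕ := s.1.1 with hj
  have hb : blk ((ℓ + 1) ^ j) z.1 = s.1.2 := (blkOf_eq_iff_blk i.D.toDomains).1 h
  have hit : (blockMap (ℓ + 1))^[j] z.1 = s.1.2 := by rw [blockMap_iterate, ← blk_eq_blockMap, hb]
  have hcorner : (blkCornerY i s).1 = blockBase ((ℓ + 1) ^ j) s.1.2 := by rw [hc', hit, blockBase_eq_smul]
  -- the retraction of `U♯` to the block box of `s`
  set lo : LSite (d + 1) := blockBase ((ℓ + 1) ^ j) s.1.2 with hlo
  set hi : LSite (d + 1) := blockBase ((ℓ + 1) ^ j) s.1.2 + ((((ℓ + 1 : ℕ) : ℤ) ^ j) - 1) • (1 : LSite (d + 1)) with hhi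
  set V : LSite (d + 1) → Fin (d + 1) → (Matrix (Fin N) (Fin N) ℂ)ˣ := retrCfg lo hi (liftCfg U) with hV
  have hagree : AgreeOn lo hi (liftCfg U) V := fun x μ hx hxe => (retrCfg_eq_of_bondIn (liftCfg U) ⟨hx, hxe⟩).symm
  have hU : ∀ μ x, U μ x ∈ unitaryUnits (Matrix (Fin N) (Fin N) ℂ) := fun μ x => hGU (mem_of_reg335P (G := G) i hreg μ x)
  have hVu : ∀ x μ, V x μ ∈ unitaryUnits (Matrix (Fin N) (Fin N) ℂ) := fun x μ => retrCfg_mem (fun x μ => liftCfg_mem hU x μ) x μ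
  have h52 : pdev V < α₀' * ((((ℓ + 1 : ℕ) : ℝ) ^ j)⁻¹) ^ 2 := pdev_retract_block_lt i hG1 U hc hMα hreg hK s
  -- both transporters read the block box only
  have hknit : compT (ℓ + 1) (bgT (ℓ + 1) (liftCfg U)) j ((blockMap (ℓ + 1))^[j] z.1) z.1 = compT (ℓ + 1) (bgT (ℓ + 1) V) j ((blockMap (ℓ + 1))^[j] z.1) z.1 :=
    compT_bgT_congr hL1 j z.1 (by rw [hit]; exact hagree)
  have htaxi : hol (liftCfg U) lo (fw (taxiDirs (z.1 - lo))) = hol V lo (fw (taxiDirs (z.1 - lo))) := hol_fw_taxiDirs_congr hb hagree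
  -- J-B's comparison at `Û_s`, scale `j`
  have hv : 0 ≤ z.1 - (blkCornerY i s).1 := fun μ => by
    have := (coord_bounds_of_blkOf i h μ).1; simp only [Pi.sub_apply, Pi.zero_apply]; linarith
  have hA : disp (fw (taxiDirs (z.1 - lo))) = z.1 - (((ℓ + 1) ^ j : ℕ) : ℤ) • (blockMap (ℓ + 1))^[j] z.1 := by
    rw [← hcorner, disp_fw_taxiDirs hv, hc']
  have hmain := compT_vs_fw hd1 (ℓ + 1) hL2 (avgClosed_unitaryUnits (d + 1) (ℓ + 1)) j hVu hα' hα3 hα2 h52 le_rfl z.1 hA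
  rw [hKeq, hSeq, hcorner, hknit, htaxi]
  have hstart : (((ℓ + 1) ^ j : ℕ) : ℤ) • (blockMap (ℓ + 1))^[j] z.1 = lo := by rw [hit, hlo, blockBase_eq_smul]
  rw [hstart] at hmain
  refine hmain.trans (le_of_eq ?_)
  have hP : (((ℓ + 1 : ℕ) : ℝ)) ^ j ≠ 0 := by positivity
  push_cast
  field_simp

/-- the `hδ` shape of J-B file 6's `hs_blkSumY_parSymY_le_knit`, on the class (3.35): `‖parSymY U c_s z − parKnitY U c_s z‖ ≤ 8(d+1)²α₀′`.
[cite: Balaban1985BackgroundPropagators, (3.19) p.393, (3.35) p.396; Balaban1985Averaging, (44) p.24] -/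
theorem norm_parSymY_sub_parKnitY_le_of_reg335P (hG1 : ∀ u : (Matrix (Fin N) (Fin N) ℂ)ˣ, u ∈ G → ‖(u : Matrix (Fin N) (Fin N) ℂ)‖ ≤ 1)
    (hGU : G ≤ unitaryUnits (Matrix (Fin N) (Fin N) ℂ))
    {U : CfgY (Matrix (Fin N) (Fin N) ℂ) i} {c₀ α₀ : ℝ} (hc : c₀ ≤ 10) (hMα : 0 ≤ (kGeo i).M * α₀)
    (hreg : (bg9KP (Matrix (Fin N) (Fin N) ℂ) G i).Reg335 c₀ α₀ U) {α₀' : ℝ} (hα' : 0 < α₀') (hα3 : C0 (d + 1) * α₀' ≤ 1 / 3)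
    (hα2 : 2 * α₀' ≤ c2' (d + 1) (ℓ + 1)) (hK : Kpl i ((kGeo i).M * α₀) * (kGeo i).L ^ 4 < α₀') {z : SiteY i} {s : BlkY i} (h : blkOf i.D.toDomains z = s) :
    ‖(parSymY i U (blkCornerY i s) z : Matrix (Fin N) (Fin N) ℂ) - parKnitY i U (blkCornerY i s) z‖ ≤ 8 * ((d : ℝ) + 1) ^ 2 * α₀' := by
  rw [norm_sub_rev]; exact norm_parKnitY_sub_parSymY_le_of_reg335P i hG1 hGU hc hMα hreg hα' hα3 hα2 hK h

end Members

end Literature.MathematicalPhysics.QuantumFieldTheory.Balaban1983to89.B9B8KnitVsTaxicabReg335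

end
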